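import Mathlib
import Summits.ValiantsHypothesis.ValiantsHypothesis.Theorems.SymmetroidPencilBasics
import Summits.ValiantsHypothesis.ValiantsHypothesis.Theorems.LacunarySymmetroidMatrixDescartesStubPerturbOddSplit
import Summits.ValiantsHypothesis.ValiantsHypothesis.Theorems.LacunarySymmetroidMatrixDescartesStubPerturbLocalSplit

/-!
# ValiantsHypothesis / LacunarySymmetroid — crux `MatrixDescartes` (stmt-ValiantsHypothesis-18050),
# line `Cruxes/MatrixDescartes/Lines/sign_split.lean`, stub `stub_perturb` (`PerturbToAlternation`,
# = `lorentzian_shadow`'s `stub_perturbT8`): PARTIAL LEMMAS — the RANK-ONE route: matrix determinant lemma with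
# the adjugate, the perturbed pencil as `p + η q`, and the stub reduced to an ORDER-OF-VANISHING condition

Helper file (`--supports stmt-ValiantsHypothesis-18050 --as helper`; cell val-lit, seat val-lit-p5 g9, merged desk
RULING #80).  Closes NO item and does NOT prove the stub; «V1 line stub; `MatrixDescartes` / Conjecture B /
`VP ≠ VNP` OPEN».

* **`det_add_vecMulVec`** — the matrix determinant lemma WITHOUT invertibility, over any commutative ring:
  `det (A + u vᵀ) = det A + v ⬝ᵥ (adj A) u` (the Mathlib TODO next to `Matrix.det_add_replicateCol_mul_replicateRow`;
  proof: column-by-column multilinear expansion, repeated columns vanish, Cramer = adjugate);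
* **`det_pencil_update_vecMulVec`** — for the lacunary pencil `F = Σ_l X^{d_l} S_l`, perturbing ONE coefficient by a
  rank-one matrix gives an AFFINE determinant: `det F[S_{l₀} ↦ S_{l₀} + c·v vᵀ] = det F + c • (X^{d_{l₀}} · adjForm)`,
  `adjForm = (C∘v) ⬝ᵥ adj(F) (C∘v) ∈ ℝ[X]`;
* **`posRootCount_le_of_adjOrder`** — THE STUB'S CONCLUSION `posRootCount ≤ 2B` for a symmetric pencil `S` under
  the stub's hypothesis, PROVIDED one vector `v` makes `q = X^{d_{l₀}} · vᵀ adj(F) v` nonzero with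
  `mult_ρ(q) < mult_ρ(det F)` at every positive root `ρ` of even multiplicity (then `…LocalSplit` splits the even
  roots, `…OddSplit` the odd ones, `…Assembly` counts).

RESIDUAL of the stub after this file (NOT proved): the existence of such a `v` for every symmetric pencil with
`det F ≢ 0` — generic `v` works: `ord_ρ adj(F) ≤ ord_ρ (det F)' = μ - 1` by Jacobi's formula
`(det F)' = tr(adj(F) · F')`, `adj(F)` is symmetric, and a nonzero real symmetric matrix `L` has `vᵀ L v ≠ 0` off a
proper quadric; one `v` serves the finitely many roots.
-/

set_option linter.dupNamespace false

namespace Summit.ValiantsHypothesis.ValiantsHypothesis.Theorems.LacunarySymmetroidMatrixDescartes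

open Polynomial Finset Matrix
open Summit.ValiantsHypothesis.ValiantsHypothesis.Theorems.SymmetroidDescartes (eval_det_pencil)

namespace Perturb

/-! ## 1. The matrix determinant lemma with the adjugate (no invertibility) -/

/-- Column-by-column expansion: adding `v_j • u` to the columns `j ∈ s` of `A` changes the determinant by
`Σ_{j ∈ s} v_j · det (A with column j replaced by u)`. -/
theorem det_add_partial_vecMulVec {n : Type*} [Fintype n] [DecidableEq n] {R : Type*} [CommRing R]
    (u v : n → R) (s : Finset n) :
    ∀ A : Matrix n n R,
      (Matrix.of fun i j => A i j + if j ∈ s then u i * v j else 0).det =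
        A.det + ∑ j ∈ s, v j * (A.updateCol j u).det := by
  induction s using Finset.induction_on with
  | empty =>
    intro A
    have : (Matrix.of fun i j => A i j + if j ∈ (∅ : Finset n) then u i * v j else 0) = A := by
      ext i j; simp
    rw [this, Finset.sum_empty, add_zero]
  | insert j s hj ih =>
    intro A
    set M : Matrix n n R := Matrix.of fun i k => A i k + if k ∈ s then u i * v k else 0 with hM
    -- the new matrix is M with column j replaced by (M col j) + v j • u
    have hcol : (Matrix.of fun i k => A i k + if k ∈ insert j s then u i * v k else 0) =
        M.updateCol j ((fun i => M i j) + v j • u) := by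
      ext i k
      rw [updateCol_apply]
      by_cases hk : k = j
      · subst hk
        simp [hM, hj, mul_comm]
      · simp [hM, hk]
    -- replacing column j of M by u gives the partial matrix of A.updateCol j u
    have hMu : M.updateCol j u =
        Matrix.of fun i k => (A.updateCol j u) i k + if k ∈ s then u i * v k else 0 := by
      ext i k
      rw [updateCol_apply]
      by_cases hk : k = j
      · subst hk
        simp [hj]
      · simp [hM, updateCol_apply, hk]
    have hzero : ∀ i ∈ s, ((A.updateCol j u).updateCol i u).det = 0 := by
      intro i hi
      have hij : i ≠ j := fun h => hj (h ▸ hi)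
      exact det_zero_of_column_eq hij fun k => by simp [updateCol_apply]
    have hz : ∑ i ∈ s, v i * ((A.updateCol j u).updateCol i u).det = 0 :=
      Finset.sum_eq_zero fun i hi => by rw [hzero i hi, mul_zero]
    rw [hcol, det_updateCol_add, updateCol_eq_self, det_updateCol_smul, hMu, ih, ih, hz, Finset.sum_insert hj]
    ring

/-- **Matrix determinant lemma with the adjugate** (any commutative ring, no invertibility):
`det (A + u vᵀ) = det A + v ⬝ᵥ adj(A) u`. -/
theorem det_add_vecMulVec {n : Type*} [Fintype n] [DecidableEq n] {R : Type*} [CommRing R]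
    (A : Matrix n n R) (u v : n → R) :
    (A + vecMulVec u v).det = A.det + v ⬝ᵥ (A.adjugate *ᵥ u) := by
  have h := det_add_partial_vecMulVec u v Finset.univ A
  have hA : (Matrix.of fun i j => A i j + if j ∈ (Finset.univ : Finset n) then u i * v j else 0) =
      A + vecMulVec u v := by
    ext i j; simp [vecMulVec_apply]
  rw [hA] at h
  rw [h, ← cramer_eq_adjugate_mulVec]
  simp only [dotProduct, cramer_apply]

/-! ## 2. The rank-one perturbed pencil has an affine determinant -/

/-- The adjugate quadratic form of the pencil along `v`: `vᵀ adj(F) v ∈ ℝ[X]`. (Written inline below; this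
lemma records the AFFINE dependence of the perturbed determinant on the size `c` of the perturbation.)
**`det F[S_{l₀} ↦ S_{l₀} + c · v vᵀ] = det F + c • (X^{d_{l₀}} · vᵀ adj(F) v)`.** -/
theorem det_pencil_update_vecMulVec {K m : ℕ} (d : Fin K → ℕ) (S : Fin K → Matrix (Fin m) (Fin m) ℝ)
    (l₀ : Fin K) (v : Fin m → ℝ) (c : ℝ) :
    (∑ l, (Polynomial.X : ℝ[X]) ^ d l •
        (Function.update S l₀ (S l₀ + c • vecMulVec v v) l).map Polynomial.C).det =
      (∑ l, (Polynomial.X : ℝ[X]) ^ d l • (S l).map Polynomial.C).det +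
        c • ((Polynomial.X : ℝ[X]) ^ d l₀ *
          ((fun i => Polynomial.C (v i)) ⬝ᵥ
            ((∑ l, (Polynomial.X : ℝ[X]) ^ d l • (S l).map Polynomial.C).adjugate *ᵥ
              fun i => Polynomial.C (v i)))) := by
  set F : Matrix (Fin m) (Fin m) ℝ[X] := ∑ l, (Polynomial.X : ℝ[X]) ^ d l • (S l).map Polynomial.C with hF
  -- the perturbed pencil is F plus a rank-one polynomial matrix
  have hsum : (∑ l, (Polynomial.X : ℝ[X]) ^ d l •
      (Function.update S l₀ (S l₀ + c • vecMulVec v v) l).map Polynomial.C) =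
        F + vecMulVec (fun i => (Polynomial.X : ℝ[X]) ^ d l₀ * Polynomial.C c * Polynomial.C (v i))
          (fun i => Polynomial.C (v i)) := by
    have hterm : ∀ l, (Polynomial.X : ℝ[X]) ^ d l •
        (Function.update S l₀ (S l₀ + c • vecMulVec v v) l).map Polynomial.C =
          (Polynomial.X : ℝ[X]) ^ d l • (S l).map Polynomial.C +
            (if l = l₀ then vecMulVec (fun i => (Polynomial.X : ℝ[X]) ^ d l₀ * Polynomial.C c *
              Polynomial.C (v i)) (fun i => Polynomial.C (v i)) else 0) := by
      intro l
      by_cases h : l = l₀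
      · subst h
        rw [Function.update_self, if_pos rfl]
        refine Matrix.ext fun i j => ?_
        simp only [Matrix.smul_apply, Matrix.add_apply, Matrix.map_apply, vecMulVec_apply, smul_eq_mul, map_add,
          map_mul]
        ring
      · rw [Function.update_of_ne h, if_neg h, add_zero]
    rw [Finset.sum_congr rfl fun l _ => hterm l, Finset.sum_add_distrib, Finset.sum_ite_eq' Finset.univ l₀,
      if_pos (Finset.mem_univ _)]
  rw [hsum, det_add_vecMulVec]
  -- pull the scalar X^{d l₀} * C c out of the bilinear form
  have hlin : (F.adjugate *ᵥ fun i => (Polynomial.X : ℝ[X]) ^ d l₀ * Polynomial.C c * Polynomial.C (v i)) =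
      ((Polynomial.X : ℝ[X]) ^ d l₀ * Polynomial.C c) • (F.adjugate *ᵥ fun i => Polynomial.C (v i)) := by
    have : (fun i => (Polynomial.X : ℝ[X]) ^ d l₀ * Polynomial.C c * Polynomial.C (v i)) =
        ((Polynomial.X : ℝ[X]) ^ d l₀ * Polynomial.C c) • fun i => Polynomial.C (v i) := by
      funext i; simp [smul_eq_mul]
    rw [this, Matrix.mulVec_smul]
  rw [hlin, dotProduct_smul, smul_eq_mul, Polynomial.smul_eq_C_mul]
  ring

/-! ## 3. The stub reduced to an order-of-vanishing condition -/

/-- **The stub from the adjugate-order condition.**  Under the hypothesis of `PerturbToAlternation` for the format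
`(d, m)` with bound `B`, a symmetric pencil `S` with `det F ≢ 0` has at most `2B` distinct positive roots PROVIDED
some vector `v` makes `q = X^{d_{l₀}} · vᵀ adj(F) v` nonzero and vanishing at every positive root of EVEN
multiplicity to a LOWER order than `det F` (odd roots: `localSplit_of_odd`; even roots: rank-one perturbation
`S_{l₀} ↦ S_{l₀} + sε v vᵀ`, whose determinant is `det F + (sε) q`, and `localSplit_of_rootMultiplicity_lt`).
The existence of such a `v` (generic `v`; Jacobi's formula) is the part NOT proved in the tree. -/
theorem posRootCount_le_of_adjOrder (K m : ℕ) (d : Fin K → ℕ) (B : ℕ)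
    (H : ∀ S : Fin K → Matrix (Fin m) (Fin m) ℝ, (∀ l, (S l).IsSymm) →
      ∀ (N : ℕ) (τ : Fin (N + 1) → ℝ),
        (StrictMono τ ∧ (∀ j, 0 < τ j) ∧ ∀ j : Fin N,
          (∑ l, (Polynomial.X : ℝ[X]) ^ d l • (S l).map Polynomial.C).det.eval (τ j.castSucc) *
            (∑ l, (Polynomial.X : ℝ[X]) ^ d l • (S l).map Polynomial.C).det.eval (τ j.succ) < 0) → N ≤ B)
    (S : Fin K → Matrix (Fin m) (Fin m) ℝ) (hS : ∀ l, (S l).IsSymm) (l₀ : Fin K) (v : Fin m → ℝ)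
    (hq : (Polynomial.X : ℝ[X]) ^ d l₀ *
        ((fun i => Polynomial.C (v i)) ⬝ᵥ
          ((∑ l, (Polynomial.X : ℝ[X]) ^ d l • (S l).map Polynomial.C).adjugate *ᵥ
            fun i => Polynomial.C (v i))) ≠ 0)
    (hord : ∀ ρ ∈ ((∑ l, (Polynomial.X : ℝ[X]) ^ d l • (S l).map Polynomial.C).det.roots.toFinset.filter
        fun ρ => 0 < ρ),
        Even ((∑ l, (Polynomial.X : ℝ[X]) ^ d l • (S l).map Polynomial.C).det.rootMultiplicity ρ) →
        ((Polynomial.X : ℝ[X]) ^ d l₀ *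
            ((fun i => Polynomial.C (v i)) ⬝ᵥ
              ((∑ l, (Polynomial.X : ℝ[X]) ^ d l • (S l).map Polynomial.C).adjugate *ᵥ
                fun i => Polynomial.C (v i)))).rootMultiplicity ρ <
          ((∑ l, (Polynomial.X : ℝ[X]) ^ d l • (S l).map Polynomial.C).det).rootMultiplicity ρ) :
    ((∑ l, (Polynomial.X : ℝ[X]) ^ d l • (S l).map Polynomial.C).det.roots.toFinset.filter
        fun ρ => 0 < ρ).card ≤ 2 * B := by
  classical
  set p := (∑ l, (Polynomial.X : ℝ[X]) ^ d l • (S l).map Polynomial.C).det with hpdef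
  set q := (Polynomial.X : ℝ[X]) ^ d l₀ *
    ((fun i => Polynomial.C (v i)) ⬝ᵥ
      ((∑ l, (Polynomial.X : ℝ[X]) ^ d l • (S l).map Polynomial.C).adjugate *ᵥ
        fun i => Polynomial.C (v i))) with hqdef
  by_cases hp : p = 0
  · simp [hp]
  have hE : (vecMulVec v v).IsSymm := by
    unfold Matrix.IsSymm; exact transpose_vecMulVec v v |>.trans (by ext i j; simp [vecMulVec_apply])
  refine posRootCount_le_of_evenSplit K m d B H S hS l₀ (vecMulVec v v) hE fun ρ hρ heven => ?_
  obtain ⟨s, hs, hloc⟩ := localSplit_of_rootMultiplicity_lt p q hp hq ρ heven (hord ρ hρ heven)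
  refine ⟨s, hs, fun δ hδ => ?_⟩
  obtain ⟨ε₀, hε₀, hε⟩ := hloc δ hδ
  refine ⟨ε₀, hε₀, fun ε hεpos hεlt => ?_⟩
  obtain ⟨a, b, ha, hab, hb, hsign⟩ := hε ε hεpos hεlt
  refine ⟨a, b, ha, hab, hb, ?_⟩
  rw [det_pencil_update_vecMulVec, ← hpdef, ← hqdef]
  exact hsign

end Perturb

end Summit.ValiantsHypothesis.ValiantsHypothesis.Theorems.LacunarySymmetroidMatrixDescartes
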